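import Summits.BirchSwinnertonDyer.BirchSwinnertonDyer.Theorems.ManinLocalTwoThreeEtaIdentityReductionForty
import Summits.BirchSwinnertonDyer.BirchSwinnertonDyer.Theorems.ManinLocalTwoThreeNeronSqueeze
import Summits.BirchSwinnertonDyer.Rank1Residual.Additive.IntModelConductorCertificate
import HarnessLib

/-!
# Level 40: the Ligozat identities of `X₀(40) → 40a1` and `|c| = 1` on `X₀(40)` — unconditionally (second level of genus `> 1`)

Cell bsd-f2-manin, route `ManinLocalTwoThree` (crux C2 `ManinOddAtFour`, stmt-22967: `2² ∣ 40`), prover seat p2 gen 27.  Sequel to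
`NewformForty`/`NewformFortyTrace`/`NewformPinningForty` (`D.f = φ₄₀ = g₁ − 2g₂` for every `X₀(40)`-datum, fact-free; Sturm at `40`),
`EtaIdentityReductionForty` (the identities from three `q`-limits; the cusp `1/20` via `W = (1 0; 20 1)`) and `EulerRemaindersForty`
(Euler truncations modulo `o(q⁹)`).  Objects: `x = η₄η₁₀⁵/(η₂η₂₀⁵)` (the tree's level-`20` function), `y = η₄²η₁₀⁴/η₂₀⁶`,
`g₁ = η₂⁵η₅²η₂₀/(η₁²η₄η₁₀)`, `g₂ = η₄²η₂₀²`.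

* §1 (T1)₄₀ `((2πi)⁻¹x′ + φ₄₀·2y)/q⁶ → 0`, (T2)₄₀ `((2πi)⁻¹y′ + φ₄₀(3x² − 6x − 4))/q⁶ → 0`, (T3)₄₀ `x³ − 3x² − 4x − y² → 0`: the
  numerators over `q^aE_*` are `o(q⁹)` with explicit witnesses (seat folder `scripts/trunc40.py`: `G₁ = X¹⁰S₁`, `G₂ = X¹⁰S₂`, `G₃ = X¹⁰S₃`
  modulo the truncation, `S₁, S₂, S₃` of `44, 41, 18` terms; the identities themselves hold to `O(q⁵⁸)` in exact arithmetic).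
* §2 The identities `x′ = −2πiφ₄₀·2y`, `y′ = −2πiφ₄₀(3x² − 6x − 4)`, **`y² = x³ − 3x² − 4x`** (= `40a1` translated by `1`), and
  **(S2)₄₀ `Λ(D.f) ⊆ Λ(28, 24)`** for every `X₀(40)`-datum.
* §3 THE NÉRON SQUEEZE at `40` (p3's general `NeronSqueeze.abs_maninConstant_eq_one_of_periodLattice_le` with the globally minimal
  `W₀ = [0, 0, 0, −7, −6] = 40a1`, `c₄ = 336`, `c₆ = 5184`, `Δ = 2⁸5²`): **`|c(D)| = 1`, hence `2 ∤ c(D)`, for every lattice-optimal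
  `X₀(40)`-datum `D` of every globally minimal elliptic `W/ℚ`** — C2's conclusion at the genus-`3` level `40`, unconditionally.

* §4 `N([0,0,0,−7,−6]) = 40` by a kernel Tate certificate (`I₁*` at `2` after `(r,s,t) = (1,1,2)`, split at `5`), and — CONDITIONAL on the item's
  own binder `exists_isNewformOf` (no CM at `40`) — the `X₀(40)`-domain of C2 is inhabited.

HONEST FRAMING: §1–§3 fact-free (axioms `propext`, `Classical.choice`, `Quot.sound`); §4's inhabitation is conditional on `exists_isNewformOf`;
nothing here proves C2 for all `N`, Manin's conjecture, or BSD. [cite: Ligozat1975, Ch. 4]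
[cite: CremonaAlgorithms1997, Table 1 (40a1), §2.10] [cite: SilvermanAEC2009, VII.1 Remark 1.1]
-/

set_option autoImplicit false
-- lint-debt: the directory name repeats the summit name (sibling precedent `ManinLocalTwoThreeEtaIdentitiesFortyEight.lean`)
set_option linter.dupNamespace false

noncomputable section

open Complex Filter Topology Set Asymptotics Polynomial
open UpperHalfPlane hiding I
open scoped Real Topology Manifold MatrixGroups ModularForm
open ModularForm CongruenceSubgroup WeierstrassCurve
open Summit.BirchSwinnertonDyer.BirchSwinnertonDyer.Rank2Observatory
open Summit.BirchSwinnertonDyer.BirchSwinnertonDyer.Rank2Observatory.Tate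
open Literature.NumberTheory.Automorphic
open Summit.BirchSwinnertonDyer.BirchSwinnertonDyer.Rank2Observatory.RootNumber
open Summit.BirchSwinnertonDyer.Rank1Residual.Additive
open Literature.NumberTheory.EllipticCurves Literature.NumberTheory.EllipticCurves.ModularForms

namespace Summit.BirchSwinnertonDyer.BirchSwinnertonDyer.Theorems.ManinLocalTwoThree.EtaIdentitiesForty

open QRemainder EulerRemainders EulerRemaindersForty EulerRemaindersTwenty NewformForty EtaIdentityReductionForty

/-! ## §1 The `q`-asymptotics (T1), (T2), (T3) at `i∞` -/

/-- **(T1)₄₀**: `((2πi)⁻¹x′ + φ₄₀·2y)/q⁶ → 0` at `i∞`. [cite: Ligozat1975, Ch. 4] -/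
theorem tendsto_T1 :
    Tendsto (fun τ : ℍ ↦ ((2 * π * I)⁻¹ * deriv (etaQuotient 20 (expFn [(2, -1), (4, 1), (10, 5), (20, -5)]) ∘ ofComplex) τ
      + (etaQuotient 40 (expFn [(1, -2), (2, 5), (4, -1), (5, 2), (10, -1), (20, 1)]) τ
          - 2 * etaQuotient 40 (expFn [(4, 2), (20, 2)]) τ)
        * (2 * etaQuotient 40 (expFn [(4, 2), (10, 4), (20, -6)]) τ))
      / Function.Periodic.qParam 1 (τ : ℂ) ^ 6) atImInfty (𝓝 0) := by
  have h2pi : (2 * π * I : ℂ) ≠ 0 := by simp [Real.pi_ne_zero, I_ne_zero]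
  have hE1 := tendsto_eulerFn_one_nine
  have hE2 := EulerRemaindersFortyEight.tendsto_eulerFn_two_nine
  have hE4 := EulerRemaindersFortyEight.tendsto_eulerFn_four_nine
  have hE5 := tendsto_eulerFn_five_nine
  have hE10 := tendsto_eulerFn (δ := 10) (m := 9) (by norm_num)
  have hE20 := tendsto_eulerFn (δ := 20) (m := 9) (by norm_num)
  have hT2 := QRemainder.congr_poly (P' := -2 * X ^ 2 - 4 * X ^ 4)
    (by rw [← mul_assoc, ← map_mul, inv_mul_cancel₀ h2pi, map_one, one_mul])
    (QRemainder.const_mul (2 * π * I)⁻¹ EulerRemaindersFortyEight.tendsto_deriv_eulerFn_two_nine)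
  have hT4 := QRemainder.congr_poly (P' := -4 * X ^ 4 - 8 * X ^ 8)
    (by rw [← mul_assoc, ← map_mul, inv_mul_cancel₀ h2pi, map_one, one_mul])
    (QRemainder.const_mul (2 * π * I)⁻¹ EulerRemaindersFortyEight.tendsto_deriv_eulerFn_four_nine)
  have hT10 := QRemainder.congr_poly (P' := 0) (by rw [mul_zero])
    (QRemainder.const_mul (2 * π * I)⁻¹ (tendsto_deriv_eulerFn (δ := 10) (m := 9) (by norm_num)))
  have hT20 := QRemainder.congr_poly (P' := 0) (by rw [mul_zero])
    (QRemainder.const_mul (2 * π * I)⁻¹ (tendsto_deriv_eulerFn (δ := 20) (m := 9) (by norm_num)))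
  -- `G₁ = E₁²E₁₀⁴·(T₄E₁₀E₂E₂₀ + 5T₁₀E₄E₂E₂₀ − 2E₄E₁₀E₂E₂₀ − T₂E₄E₁₀E₂₀ − 5T₂₀E₄E₁₀E₂) + 2E₂⁷E₄E₅²E₁₀³E₂₀ − 4qE₁²E₂²E₄⁴E₁₀⁴E₂₀² = o(q⁹)`
  have hinner := QRemainder.sub (QRemainder.sub (QRemainder.sub (QRemainder.add
    (QRemainder.mul (QRemainder.mul (QRemainder.mul hT4 hE10) hE2) hE20)
    (QRemainder.mul (QRemainder.mul (QRemainder.mul (QRemainder.const_mul 5 hT10) hE4) hE2) hE20))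
    (QRemainder.mul (QRemainder.mul (QRemainder.mul (QRemainder.const_mul 2 hE4) hE10) hE2) hE20))
    (QRemainder.mul (QRemainder.mul (QRemainder.mul hT2 hE4) hE10) hE20))
    (QRemainder.mul (QRemainder.mul (QRemainder.mul (QRemainder.const_mul 5 hT20) hE4) hE10) hE2)
  have h1 := QRemainder.mul (QRemainder.mul (QRemainder.pow hE1 2) (QRemainder.pow hE10 4)) hinner
  have h2 := QRemainder.mul (QRemainder.mul (QRemainder.mul (QRemainder.mul (QRemainder.const_mul 2 (QRemainder.pow hE2 7)) hE4)
    (QRemainder.pow hE5 2)) (QRemainder.pow hE10 3)) hE20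
  have h3 := QRemainder.const_mul 4 (QRemainder.qParam_pow_mul 1 (QRemainder.mul (QRemainder.mul (QRemainder.mul (QRemainder.mul
    (QRemainder.pow hE1 2) (QRemainder.pow hE2 2)) (QRemainder.pow hE4 4)) (QRemainder.pow hE10 4)) (QRemainder.pow hE20 2)))
  have hG := QRemainder.reduce 0
    (48 - 112 * X - 56 * X ^ 2 + 192 * X ^ 3 - 30 * X ^ 4 + 228 * X ^ 5 - 96 * X ^ 6 - 472 * X ^ 7 - 38 * X ^ 8 - 76 * X ^ 9
      + 406 * X ^ 10 + 416 * X ^ 11 + 206 * X ^ 12 - 348 * X ^ 13 - 360 * X ^ 14 - 12 * X ^ 15 - 400 * X ^ 16 + 368 * X ^ 17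
      - 54 * X ^ 18 - 12 * X ^ 19 + 210 * X ^ 20 + 88 * X ^ 21 + 298 * X ^ 22 - 132 * X ^ 23 + 154 * X ^ 24 - 308 * X ^ 25
      - 126 * X ^ 26 - 108 * X ^ 27 - 136 * X ^ 28 + 76 * X ^ 29 - 88 * X ^ 30 + 172 * X ^ 31 - 10 * X ^ 32 + 128 * X ^ 33
      + 38 * X ^ 34 + 36 * X ^ 35 + 18 * X ^ 36 - 32 * X ^ 37 + 16 * X ^ 38 - 48 * X ^ 39 + 8 * X ^ 40 - 32 * X ^ 41
      - 16 * X ^ 43 - 4 * X ^ 45)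
    (by simp only [map_ofNat]; ring) (QRemainder.sub (QRemainder.add h1 h2) h3)
  have hlim := (QRemainder.tendsto_div_pow 8 (by norm_num) hG).mul
    (((((isIntUnitQExp_eulerFn (by norm_num : 0 < 1)).tendsto_one.pow 2).mul
      ((isIntUnitQExp_eulerFn (by norm_num : 0 < 2)).tendsto_one.pow 2)).mul
      ((isIntUnitQExp_eulerFn (by norm_num : 0 < 20)).tendsto_one.pow 6)).inv₀ (by norm_num))
  rw [zero_mul] at hlim
  refine hlim.congr fun τ ↦ ?_
  have hE1' := eulerFn_ne_zero (by norm_num : 0 < 1) τ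
  have hE2' := eulerFn_ne_zero (by norm_num : 0 < 2) τ
  have hE4' := eulerFn_ne_zero (by norm_num : 0 < 4) τ
  have hE5' := eulerFn_ne_zero (by norm_num : 0 < 5) τ
  have hE10' := eulerFn_ne_zero (by norm_num : 0 < 10) τ
  have hE20' := eulerFn_ne_zero (by norm_num : 0 < 20) τ
  have hq := qParam_ne_zero τ
  rw [deriv_x20, y40_eq, g1_eq, g2_eq]
  field_simp
  ring

/-- **(T2)₄₀**: `((2πi)⁻¹y′ + φ₄₀(3x² − 6x − 4))/q⁶ → 0` at `i∞`. [cite: Ligozat1975, Ch. 4] -/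
theorem tendsto_T2 :
    Tendsto (fun τ : ℍ ↦ ((2 * π * I)⁻¹ * deriv (etaQuotient 40 (expFn [(4, 2), (10, 4), (20, -6)]) ∘ ofComplex) τ
      + (etaQuotient 40 (expFn [(1, -2), (2, 5), (4, -1), (5, 2), (10, -1), (20, 1)]) τ
          - 2 * etaQuotient 40 (expFn [(4, 2), (20, 2)]) τ)
        * (3 * etaQuotient 20 (expFn [(2, -1), (4, 1), (10, 5), (20, -5)]) τ ^ 2
          - 6 * etaQuotient 20 (expFn [(2, -1), (4, 1), (10, 5), (20, -5)]) τ - 4))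
      / Function.Periodic.qParam 1 (τ : ℂ) ^ 6) atImInfty (𝓝 0) := by
  have h2pi : (2 * π * I : ℂ) ≠ 0 := by simp [Real.pi_ne_zero, I_ne_zero]
  have hE1 := tendsto_eulerFn_one_nine
  have hE2 := EulerRemaindersFortyEight.tendsto_eulerFn_two_nine
  have hE4 := EulerRemaindersFortyEight.tendsto_eulerFn_four_nine
  have hE5 := tendsto_eulerFn_five_nine
  have hE10 := tendsto_eulerFn (δ := 10) (m := 9) (by norm_num)
  have hE20 := tendsto_eulerFn (δ := 20) (m := 9) (by norm_num)
  have hT4 := QRemainder.congr_poly (P' := -4 * X ^ 4 - 8 * X ^ 8)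
    (by rw [← mul_assoc, ← map_mul, inv_mul_cancel₀ h2pi, map_one, one_mul])
    (QRemainder.const_mul (2 * π * I)⁻¹ EulerRemaindersFortyEight.tendsto_deriv_eulerFn_four_nine)
  have hT10 := QRemainder.congr_poly (P' := 0) (by rw [mul_zero])
    (QRemainder.const_mul (2 * π * I)⁻¹ (tendsto_deriv_eulerFn (δ := 10) (m := 9) (by norm_num)))
  have hT20 := QRemainder.congr_poly (P' := 0) (by rw [mul_zero])
    (QRemainder.const_mul (2 * π * I)⁻¹ (tendsto_deriv_eulerFn (δ := 20) (m := 9) (by norm_num)))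
  -- `G₂ = E₁²E₂²E₄²E₁₀⁴E₂₀³·(2T₄E₁₀E₂₀ + 4T₁₀E₄E₂₀ − 3E₄E₁₀E₂₀ − 6T₂₀E₄E₁₀) + A·B = o(q⁹)`,
  -- `A = E₂⁵E₅²E₂₀ − 2qE₁²E₄³E₁₀E₂₀²`, `B = 3E₄²E₁₀¹⁰ − 6q²E₂E₄E₁₀⁵E₂₀⁵ − 4q⁴E₂²E₂₀¹⁰`
  have hinner := QRemainder.sub (QRemainder.sub (QRemainder.add
    (QRemainder.mul (QRemainder.mul (QRemainder.const_mul 2 hT4) hE10) hE20)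
    (QRemainder.mul (QRemainder.mul (QRemainder.const_mul 4 hT10) hE4) hE20))
    (QRemainder.mul (QRemainder.mul (QRemainder.const_mul 3 hE4) hE10) hE20))
    (QRemainder.mul (QRemainder.mul (QRemainder.const_mul 6 hT20) hE4) hE10)
  have h1 := QRemainder.mul (QRemainder.mul (QRemainder.mul (QRemainder.mul (QRemainder.mul
    (QRemainder.pow hE1 2) (QRemainder.pow hE2 2)) (QRemainder.pow hE4 2)) (QRemainder.pow hE10 4)) (QRemainder.pow hE20 3)) hinner
  have hA := QRemainder.sub (QRemainder.mul (QRemainder.mul (QRemainder.pow hE2 5) (QRemainder.pow hE5 2)) hE20)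
    (QRemainder.const_mul 2 (QRemainder.qParam_pow_mul 1 (QRemainder.mul (QRemainder.mul (QRemainder.mul
      (QRemainder.pow hE1 2) (QRemainder.pow hE4 3)) hE10) (QRemainder.pow hE20 2))))
  have hB := QRemainder.sub (QRemainder.sub
    (QRemainder.const_mul 3 (QRemainder.mul (QRemainder.pow hE4 2) (QRemainder.pow hE10 10)))
    (QRemainder.const_mul 6 (QRemainder.qParam_pow_mul 2 (QRemainder.mul (QRemainder.mul (QRemainder.mul hE2 hE4)
      (QRemainder.pow hE10 5)) (QRemainder.pow hE20 5)))))
    (QRemainder.const_mul 4 (QRemainder.qParam_pow_mul 4 (QRemainder.mul (QRemainder.pow hE2 2) (QRemainder.pow hE20 10))))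
  have hG := QRemainder.reduce 0
    (52 - 128 * X - 87 * X ^ 2 + 294 * X ^ 3 - 92 * X ^ 4 + 340 * X ^ 5 + 26 * X ^ 6 - 1076 * X ^ 7 + 40 * X ^ 8 + 630 * X ^ 10
      + 1124 * X ^ 11 + 76 * X ^ 12 - 806 * X ^ 13 - 1114 * X ^ 14 + 148 * X ^ 15 - 448 * X ^ 16 + 788 * X ^ 17 + 557 * X ^ 18
      - 274 * X ^ 19 + 572 * X ^ 20 - 224 * X ^ 21 + 198 * X ^ 22 - 692 * X ^ 23 - 96 * X ^ 24 - 212 * X ^ 25 - 300 * X ^ 26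
      + 408 * X ^ 27 + 370 * X ^ 29 - 28 * X ^ 30 + 256 * X ^ 31 - 12 * X ^ 32 - 52 * X ^ 33 + 31 * X ^ 34 - 118 * X ^ 35
      - 24 * X ^ 36 - 116 * X ^ 37 + 24 * X ^ 38 - 56 * X ^ 39 - 12 * X ^ 40 - 8 * X ^ 41 + 6 * X ^ 45)
    (by simp only [map_ofNat]; ring) (QRemainder.add h1 (QRemainder.mul hA hB))
  have hlim := (QRemainder.tendsto_div_pow 9 le_rfl hG).mul
    (((((((isIntUnitQExp_eulerFn (by norm_num : 0 < 1)).tendsto_one.pow 2).mul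
      ((isIntUnitQExp_eulerFn (by norm_num : 0 < 2)).tendsto_one.pow 2)).mul
      ((isIntUnitQExp_eulerFn (by norm_num : 0 < 4)).tendsto_one.pow 1)).mul
      ((isIntUnitQExp_eulerFn (by norm_num : 0 < 10)).tendsto_one.pow 1)).mul
      ((isIntUnitQExp_eulerFn (by norm_num : 0 < 20)).tendsto_one.pow 10)).inv₀ (by norm_num))
  rw [zero_mul] at hlim
  refine hlim.congr fun τ ↦ ?_
  have hE1' := eulerFn_ne_zero (by norm_num : 0 < 1) τ
  have hE2' := eulerFn_ne_zero (by norm_num : 0 < 2) τ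
  have hE4' := eulerFn_ne_zero (by norm_num : 0 < 4) τ
  have hE5' := eulerFn_ne_zero (by norm_num : 0 < 5) τ
  have hE10' := eulerFn_ne_zero (by norm_num : 0 < 10) τ
  have hE20' := eulerFn_ne_zero (by norm_num : 0 < 20) τ
  have hq := qParam_ne_zero τ
  rw [deriv_y40, x20_eq, g1_eq, g2_eq]
  field_simp

/-- **(T3)₄₀**: `x³ − 3x² − 4x − y² → 0` at `i∞`. [cite: Ligozat1975, Ch. 4] -/
theorem tendsto_T3 :
    Tendsto (fun τ : ℍ ↦ etaQuotient 20 (expFn [(2, -1), (4, 1), (10, 5), (20, -5)]) τ ^ 3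
      - 3 * etaQuotient 20 (expFn [(2, -1), (4, 1), (10, 5), (20, -5)]) τ ^ 2
      - 4 * etaQuotient 20 (expFn [(2, -1), (4, 1), (10, 5), (20, -5)]) τ
      - etaQuotient 40 (expFn [(4, 2), (10, 4), (20, -6)]) τ ^ 2) atImInfty (𝓝 0) := by
  have hE2 := EulerRemaindersFortyEight.tendsto_eulerFn_two_nine
  have hE4 := EulerRemaindersFortyEight.tendsto_eulerFn_four_nine
  have hE10 := tendsto_eulerFn (δ := 10) (m := 9) (by norm_num)
  have hE20 := tendsto_eulerFn (δ := 20) (m := 9) (by norm_num)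
  -- `G₃ = E₄³E₁₀¹⁵ − 3q²E₂E₄²E₁₀¹⁰E₂₀⁵ − 4q⁴E₂²E₄E₁₀⁵E₂₀¹⁰ − E₂³E₄⁴E₁₀⁸E₂₀³ = o(q⁹)`
  have h1 := QRemainder.mul (QRemainder.pow hE4 3) (QRemainder.pow hE10 15)
  have h2 := QRemainder.const_mul 3 (QRemainder.qParam_pow_mul 2 (QRemainder.mul (QRemainder.mul (QRemainder.mul hE2
    (QRemainder.pow hE4 2)) (QRemainder.pow hE10 10)) (QRemainder.pow hE20 5)))
  have h3 := QRemainder.const_mul 4 (QRemainder.qParam_pow_mul 4 (QRemainder.mul (QRemainder.mul (QRemainder.mul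
    (QRemainder.pow hE2 2) hE4) (QRemainder.pow hE10 5)) (QRemainder.pow hE20 10)))
  have h4 := QRemainder.mul (QRemainder.mul (QRemainder.mul (QRemainder.pow hE2 3) (QRemainder.pow hE4 4)) (QRemainder.pow hE10 8))
    (QRemainder.pow hE20 3)
  have hG := QRemainder.reduce 0
    (10 - 9 * X ^ 2 - 7 * X ^ 4 + 7 * X ^ 6 - 38 * X ^ 8 + 14 * X ^ 10 + 28 * X ^ 12 + 5 * X ^ 14 + 31 * X ^ 16 - 9 * X ^ 18
      - 22 * X ^ 20 - 9 * X ^ 22 - 11 * X ^ 24 + 2 * X ^ 26 + 7 * X ^ 28 + 4 * X ^ 30 + 3 * X ^ 32 + X ^ 34)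
    (by simp only [map_ofNat]; ring) (QRemainder.sub (QRemainder.sub (QRemainder.sub h1 h2) h3) h4)
  have hlim := (QRemainder.tendsto_div_pow 6 (by norm_num) hG).mul
    ((((isIntUnitQExp_eulerFn (by norm_num : 0 < 2)).tendsto_one.pow 3).mul
      ((isIntUnitQExp_eulerFn (by norm_num : 0 < 20)).tendsto_one.pow 15)).inv₀ (by norm_num))
  rw [zero_mul] at hlim
  refine hlim.congr fun τ ↦ ?_
  have hE2' := eulerFn_ne_zero (by norm_num : 0 < 2) τ
  have hE20' := eulerFn_ne_zero (by norm_num : 0 < 20) τ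
  have hq := qParam_ne_zero τ
  rw [x20_eq, y40_eq]
  field_simp

/-! ## §2 The identities and (S2)₄₀ -/

section Phi

variable (φ : CuspForm (Gamma0 40) 2)
  (hφ : ⇑φ = fun τ ↦ etaQuotient 40 (expFn [(1, -2), (2, 5), (4, -1), (5, 2), (10, -1), (20, 1)]) τ
      - 2 * etaQuotient 40 (expFn [(4, 2), (20, 2)]) τ)
include hφ

/-- **(I2a)**: `x′ = −2πi φ₄₀ · 2y` on `ℍ`. [cite: Ligozat1975, Ch. 4] -/
theorem deriv_x40_identity (τ : ℍ) :
    deriv (etaQuotient 20 (expFn [(2, -1), (4, 1), (10, 5), (20, -5)]) ∘ ofComplex) τ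
      = -(2 * π * I * φ τ) * (2 * etaQuotient 40 (expFn [(4, 2), (10, 4), (20, -6)]) τ) := by
  refine deriv_x40_of_tendsto φ hφ ?_ τ
  simpa only [hφ] using tendsto_T1

/-- **(I2b)**: `y′ = −2πi φ₄₀ · (3x² − 6x − 4)` on `ℍ`. [cite: Ligozat1975, Ch. 4] -/
theorem deriv_y40_identity (τ : ℍ) :
    deriv (etaQuotient 40 (expFn [(4, 2), (10, 4), (20, -6)]) ∘ ofComplex) τ
      = -(2 * π * I * φ τ) * (3 * etaQuotient 20 (expFn [(2, -1), (4, 1), (10, 5), (20, -5)]) τ ^ 2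
          - 6 * etaQuotient 20 (expFn [(2, -1), (4, 1), (10, 5), (20, -5)]) τ - 4) := by
  refine deriv_y40_of_tendsto φ hφ ?_ τ
  simpa only [hφ] using tendsto_T2

/-- **(I1): the cubic `y² = x³ − 3x² − 4x` on `ℍ`** — the functions `x, y` parametrise `[0, −3, 0, −4, 0]`, Cremona's
`40a1 = [0, 0, 0, −7, −6]` translated by `x ↦ x − 1`. [cite: CremonaAlgorithms1997, Table 1 (40a1)] -/
theorem cubic40 (τ : ℍ) :
    etaQuotient 20 (expFn [(2, -1), (4, 1), (10, 5), (20, -5)]) τ ^ 3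
      - 3 * etaQuotient 20 (expFn [(2, -1), (4, 1), (10, 5), (20, -5)]) τ ^ 2
      - 4 * etaQuotient 20 (expFn [(2, -1), (4, 1), (10, 5), (20, -5)]) τ
      = etaQuotient 40 (expFn [(4, 2), (10, 4), (20, -6)]) τ ^ 2 :=
  cubic40_of_deriv φ (deriv_x40_identity φ hφ) (deriv_y40_identity φ hφ) tendsto_T3 τ

/-- **(S2)₄₀: `Λ(φ₄₀) ⊆ Λ(28, 24)`**, the lattice of the Néron invariants `c₄/12, c₆/216` of `40a1`. [cite: CremonaAlgorithms1997, §2.10] -/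
theorem periodLatticeLe_forty :
    ∃ L₁ : PeriodPair, L₁.g₂ = 28 ∧ L₁.g₃ = 24 ∧ ∀ z ∈ periodLattice φ, z ∈ L₁.lattice :=
  periodLatticeLe40_of_etaIdentities φ hφ (cubic40 φ hφ) (deriv_x40_identity φ hφ)

end Phi

/-! ## §3 The Néron squeeze at level `40`: `|c| = 1` on `X₀(40)` -/

/-- The literal `ℚ`-model `[0, 0, 0, −7, −6]` read through integer casts. [folklore] -/
theorem mk_fortyA1_eq_cast :
    (⟨0, 0, 0, -7, -6⟩ : WeierstrassCurve ℚ) = ⟨((0 : ℤ) : ℚ), ((0 : ℤ) : ℚ), ((0 : ℤ) : ℚ), ((-7 : ℤ) : ℚ), ((-6 : ℤ) : ℚ)⟩ := by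
  ext <;> norm_num

/-- `40a1 = [0, 0, 0, −7, −6]` is globally minimal (`Δ = 2⁸5²`, `v₂(Δ) = 8 < 12`, `5 ∤ c₄ = 336`; kernel certificate).
[cite: SilvermanAEC2009, VII.1 Remark 1.1] -/
theorem isGloballyMinimal_fortyA1 : (⟨0, 0, 0, -7, -6⟩ : WeierstrassCurve ℚ).IsGloballyMinimal := by
  rw [mk_fortyA1_eq_cast]
  exact IntModelCond.isGloballyMinimal_mk_of_minCheck 0 0 0 (-7) (-6) (cm := ⟨8, 4, 6, [⟨5, 2, 2, 0, 0⟩]⟩) (by decide +kernel)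

/-- `[0, 0, 0, −7, −6]` is an elliptic curve (`Δ = 6400 ≠ 0`); a theorem, use `haveI`. [folklore] -/
theorem isElliptic_fortyA1 : (⟨0, 0, 0, -7, -6⟩ : WeierstrassCurve ℚ).IsElliptic :=
  ⟨by norm_num [WeierstrassCurve.Δ, WeierstrassCurve.b₂, WeierstrassCurve.b₄, WeierstrassCurve.b₆, WeierstrassCurve.b₈]⟩

/-- **The Néron invariants of `40a1`**: `c₄ = 336`, `c₆ = 5184`, so `IsNeronLatticeOf (W₀/ℂ) L ⟺ (g₂(L), g₃(L)) = (28, 24)`.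
[cite: CremonaAlgorithms1997, Table 1 (40a1)] -/
theorem isNeronLatticeOf_fortyA1_iff (L : PeriodPair) :
    IsNeronLatticeOf ((⟨0, 0, 0, -7, -6⟩ : WeierstrassCurve ℚ).baseChange ℂ) L ↔ L.g₂ = 28 ∧ L.g₃ = 24 := by
  have h4 : ((⟨0, 0, 0, -7, -6⟩ : WeierstrassCurve ℚ).baseChange ℂ).c₄ = (((⟨0, 0, 0, -7, -6⟩ : WeierstrassCurve ℚ).c₄ : ℚ) : ℂ) := by
    simp [WeierstrassCurve.baseChange, WeierstrassCurve.map_c₄]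
  have h6 : ((⟨0, 0, 0, -7, -6⟩ : WeierstrassCurve ℚ).baseChange ℂ).c₆ = (((⟨0, 0, 0, -7, -6⟩ : WeierstrassCurve ℚ).c₆ : ℚ) : ℂ) := by
    simp [WeierstrassCurve.baseChange, WeierstrassCurve.map_c₆]
  have h4' : (⟨0, 0, 0, -7, -6⟩ : WeierstrassCurve ℚ).c₄ = 336 := by
    norm_num [WeierstrassCurve.c₄, WeierstrassCurve.b₂, WeierstrassCurve.b₄]
  have h6' : (⟨0, 0, 0, -7, -6⟩ : WeierstrassCurve ℚ).c₆ = 5184 := by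
    norm_num [WeierstrassCurve.c₆, WeierstrassCurve.b₂, WeierstrassCurve.b₄, WeierstrassCurve.b₆]
  rw [IsNeronLatticeOf, h4, h6, h4', h6']
  push_cast
  constructor
  · rintro ⟨ha, hb⟩; exact ⟨by rw [ha]; norm_num, by rw [hb]; norm_num⟩
  · rintro ⟨ha, hb⟩; exact ⟨by rw [ha]; norm_num, by rw [hb]; norm_num⟩

/-- **`|c| = 1` for every lattice-optimal `X₀(40)`-datum of every globally minimal elliptic `W/ℚ`** — UNCONDITIONAL (newform pinning
`D.f = φ₄₀` by `NewformPinningForty`, (S2)₄₀ by the `η`-identities, the Néron squeeze with `W₀ = 40a1`).  The second level of the C2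
domain with `g(X₀(N)) > 1`. [cite: CremonaAlgorithms1997, §2.10, Table 1 (40a1)] -/
theorem abs_maninConstant_eq_one_forty (W : WeierstrassCurve ℚ) [W.IsElliptic] [W.IsGloballyMinimal]
    (D : ModularParametrizationData W 40)
    (hopt : ∀ z ∈ D.L.lattice, ∃ w ∈ periodLattice D.f, z = D.c * w) :
    |D.maninConstant| = 1 := by
  haveI := isElliptic_fortyA1
  haveI := isGloballyMinimal_fortyA1
  obtain ⟨L₁, h2, h3, hle⟩ := periodLatticeLe_forty D.f (f_apply_eq_phi40 D)
  exact NeronSqueeze.abs_maninConstant_eq_one_of_periodLattice_le (⟨0, 0, 0, -7, -6⟩ : WeierstrassCurve ℚ) L₁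
    ((isNeronLatticeOf_fortyA1_iff L₁).mpr ⟨h2, h3⟩) W D hle hopt

/-- **C2 `ManinOddAtFour` at `N = 40` (`2² ∣ 40`): `2 ∤ c(D)`** for every lattice-optimal `X₀(40)`-datum — UNCONDITIONAL. [folklore] -/
theorem not_two_dvd_maninConstant_forty (W : WeierstrassCurve ℚ) [W.IsElliptic] [W.IsGloballyMinimal]
    (D : ModularParametrizationData W 40)
    (hopt : ∀ z ∈ D.L.lattice, ∃ w ∈ periodLattice D.f, z = D.c * w) :
    ¬ (2 : ℤ) ∣ D.maninConstant := by
  have h := abs_maninConstant_eq_one_forty W D hopt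
  intro h2
  have := Int.le_of_dvd (by rw [h]; norm_num) ((dvd_abs _ _).mpr h2)
  rw [h] at this
  norm_num at this

/-- `2² ∣ 40`: the level `40` lies in C2's `4 ∣ N` world. [folklore] -/
theorem two_sq_dvd_forty : 2 ^ 2 ∣ 40 := ⟨10, by norm_num⟩

/-- **The C2 conclusion on the whole `X₀(40)`-domain**: `|c| = 1 ∧ 2 ∤ c` for every lattice-optimal `X₀(40)`-datum of every globally
minimal elliptic curve over `ℚ` (and `2² ∣ 40`) — UNCONDITIONAL; BSD and C2 for general `N` are NOT proved by this. [folklore] -/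
theorem maninOddAtFour_forty :
    2 ^ 2 ∣ 40 ∧ ∀ (W : WeierstrassCurve ℚ) [W.IsElliptic] [W.IsGloballyMinimal] (D : ModularParametrizationData W 40),
      (∀ z ∈ D.L.lattice, ∃ w ∈ periodLattice D.f, z = D.c * w) → |D.maninConstant| = 1 ∧ ¬ (2 : ℤ) ∣ D.maninConstant :=
  ⟨two_sq_dvd_forty, fun W _ _ D hopt ↦
    ⟨abs_maninConstant_eq_one_forty W D hopt, not_two_dvd_maninConstant_forty W D hopt⟩⟩

/-! ## §4 `N(40a1) = 40` (kernel Tate certificate) and the `X₀(40)`-domain under the item's modularity binder -/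

/-- **`N([0, 0, 0, −7, −6]) = 40 = 2³·5`**: deep Tate certificate at `2` = change `(r, s, t) = (1, 1, 2)` to `[2, 2, 4, −8, −16]`, exit `I₁*`
(`2 ∥ a₂`, `4 ∥ a₃`, `8 ∣ a₄`, `16 ∣ a₆`; `f₂ = v₂(Δ) + 1 − 6 = 3`), good at `3`, split multiplicative at `5` (node-tangent root `t = 2`);
all kernel-checked. [cite: Silverman1994, IV.9.4] [cite: CremonaAlgorithms1997, Table 1 (40a1)] -/
theorem conductorNorm_fortyA1 : (⟨0, 0, 0, -7, -6⟩ : WeierstrassCurve ℚ).conductorNorm ℤ = 40 := by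
  rw [mk_fortyA1_eq_cast]
  exact IntModelCond.conductorNorm_mk_eq_of_certs_of_eq 0 0 0 (-7) (-6)
    (cm := ⟨8, 4, 6, [⟨5, 2, 2, 1, 2⟩]⟩) (c := ⟨8, 4, 6, 0, 1, 4, [⟨5, 2, 2, 1, 2⟩]⟩)
    (l₂ := ⟨3, 1, 1, 2, 8, 71, 0⟩) (l₃ := ⟨0, 0, 0, 0, 0, 0, 0⟩)
    (by decide +kernel) (by decide +kernel) (by decide +kernel) (by decide +kernel) (by decide +kernel)

/-- **Modularity at `40a1`, levelled**: under `exists_isNewformOf` the curve `[0, 0, 0, −7, −6]` has a newform in `S₂(Γ₀(40))` (its conductor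
IS `40`).  CONDITIONAL on the item's own binder `exists_isNewformOf` (no CM: a fact-free proof is not claimed). [cite: DiamondShurman2005, Thm. 8.8.3] -/
theorem exists_isNewformOf_fortyA1 (hnf : exists_isNewformOf) :
    ∃ f : CuspForm (Gamma0 40) 2, IsNewformOf (⟨0, 0, 0, -7, -6⟩ : WeierstrassCurve ℚ) f := by
  haveI := isElliptic_fortyA1
  have key : ∀ (N : ℕ) [NeZero N], (⟨0, 0, 0, -7, -6⟩ : WeierstrassCurve ℚ).conductorNorm ℤ = N →
      ∃ f : CuspForm (Gamma0 N) 2, IsNewformOf (⟨0, 0, 0, -7, -6⟩ : WeierstrassCurve ℚ) f := by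
    intro N _ hN
    subst hN
    exact hnf _
  haveI : NeZero (40 : ℕ) := ⟨by decide⟩
  exact key 40 conductorNorm_fortyA1

/-- Under modularity the newform of `40a1` IS `φ₄₀ = g₁ − 2g₂`: `aₙ(φ₄₀) = aₙ([0, 0, 0, −7, −6])` for all `n`.  CONDITIONAL on `exists_isNewformOf`.
[cite: CremonaAlgorithms1997, Table 3 (N = 40)] -/
theorem cuspCoeff_phi40_eq_lFunction_fortyA1_of_modularity (hnf : exists_isNewformOf) (φ : CuspForm (Gamma0 40) 2)
    (hφ : ⇑φ = fun τ ↦ etaQuotient 40 (expFn [(1, -2), (2, 5), (4, -1), (5, 2), (10, -1), (20, 1)]) τ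
      - 2 * etaQuotient 40 (expFn [(4, 2), (20, 2)]) τ) (n : ℕ) :
    cuspCoeff φ n = ((⟨0, 0, 0, -7, -6⟩ : WeierstrassCurve ℚ).LFunction n : ℂ) := by
  obtain ⟨f, hf⟩ := exists_isNewformOf_fortyA1 hnf
  obtain ⟨G₂, hG₂⟩ := exists_cuspForm_g2
  rw [← eq_phi40_of_isNewform0 φ G₂ hφ hG₂ hf.1]
  exact hf.2 n

/-- **A lattice-optimal `X₀(40)`-datum on a global minimal model in the class `40a` exists under modularity**, i.e. C2's `∀`-domain at `N = 40`
is inhabited relative to the item's hypotheses; CONDITIONAL on `exists_isNewformOf` only. [cite: EdixhovenManin1991, Prop. 2] -/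
theorem maninOddAtFour_domain_inhabited_forty_of_modularity (hnf : exists_isNewformOf) :
    ∃ (W₀ : WeierstrassCurve ℚ) (_ : W₀.IsElliptic) (_ : W₀.IsGloballyMinimal) (D₀ : ModularParametrizationData W₀ 40),
      (⟨0, 0, 0, -7, -6⟩ : WeierstrassCurve ℚ).IsIsogenous W₀ ∧ (∀ z ∈ D₀.L.lattice, ∃ w ∈ periodLattice D₀.f, z = D₀.c * w) ∧
      |D₀.maninConstant| = 1 ∧ 2 ^ 2 ∣ 40 := by
  haveI := isElliptic_fortyA1
  haveI : NeZero (40 : ℕ) := ⟨by decide⟩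
  obtain ⟨f, hf⟩ := exists_isNewformOf_fortyA1 hnf
  obtain ⟨D⟩ := nonempty_modularParametrizationData_of_isNewformOf hf
  obtain ⟨W₀, h₀, hmin, D₀, -, hiso, hopt, -⟩ :=
    ExistsMinimalOptimalDatum.existsMinimalOptimalDatum_full (⟨0, 0, 0, -7, -6⟩ : WeierstrassCurve ℚ) D
  exact ⟨W₀, h₀, hmin, D₀, hiso, hopt, @abs_maninConstant_eq_one_forty W₀ h₀ hmin D₀ hopt, two_sq_dvd_forty⟩

end Summit.BirchSwinnertonDyer.BirchSwinnertonDyer.Theorems.ManinLocalTwoThree.EtaIdentitiesForty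

end
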